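import Literature.NumberTheory.GaloisRepresentations.SerreWeightEqTwoShapesProofs
import Literature.NumberTheory.GaloisRepresentations.SerreWeightLevelOneSwapProofs
import HarnessLib

/-!
# Serre's recipe at a GENERIC level-one shape `(ψ₁^β ∗; 0 ψ₁^α)`, `1 ≤ α, β ≤ q − 2`, `|α − β| ≠ 1`:
# `k(ρ̄_F) = 1 + q·min(α, β) + max(α, β)` UNCONDITIONALLY (no uniqueness hypothesis)

Topic `NumberTheory/GaloisRepresentations`.  A *proofs* file (theorems only: no definition, no named fact, no `sorry`, no instance,
no notation).  Sequel of `SerreWeightEqTwoShapesProofs` (the shape `(1, 0)`, `k = 2`) and of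
`SerreWeightLevelOneEvaluationOfUniqueProofs` / `SerreWeightLevelOneSwapProofs` (the same values GRANTED the named fact
`IsSerreWeight.unique`); here the uniqueness is PROVED in the generic range, following Serre's own argument:

* `not_isLevelTwoWeight_of_hasLevelOneInertiaShape` — a representation with a level-one shape has no level-two weight: the
  diagonal characters agree up to order (`diagChar_eq_or_eq_swap`), so `ψ₂^{a+qb}` is a power of `ψ₁`, whence
  `(ψ₂^{a+qb})^{q−1} = 1`, `q² − 1 ∣ (a + qb)(q − 1)`, `q + 1 ∣ a + qb ≡ a − b`, contradicting `0 < b − a < q + 1`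
  (Serre §2.2: level-two characters have `a ≠ b`);
* `serreWeightLocal_eq_of_hasLevelOneInertiaShape_generic` — for `1 ≤ α, β`, `α + 2 ≤ q`, `β + 2 ≤ q`, `β ≠ α + 1`, `α ≠ β + 1`:
  `serreWeightLocal ρ ι = 1 + q·min(α, β) + max(α, β)`.  TAME case: every tame normalisation `(a', b')` has
  `{ψ₁^{a'}, ψ₁^{b'}} = {ψ₁^β, ψ₁^α}`, so `{a', b'} = {α, β}` (`ψ₁` has order `q − 1`, all exponents `≤ q − 2`), and the shape
  `(min, max)` is available after the swap `HasLevelOneInertiaShape.symm_of_isTamelyRamified`; WILD case: every wild normalisation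
  `(β', α')` has `{β', α'} = {β, α}` (the value `β' = q − 1` is excluded since neither `ψ₁^β` nor `ψ₁^α` is trivial) and
  `β' ≠ α' + 1`, so §2.4 (i) gives the same number;
* `serreWeight_eq_of_hasLevelOneInertiaShape_generic` — the global wrapper at a local restriction datum (`q = p`).

Consumer: route BSD/TeichmullerTwistDescent, crux `TwistedPeriodLatticeSaturation`, input (W‴) (types II and IV), where it removes
the hypotheses `IsSerreWeight.unique` and `isSerreWeight_serreWeightLocal` from `TeichmullerTwistDescentWeightExclusionType{II,IV}`.
References: J.-P. Serre, Duke Math. J. 54 (1987), §2.1 Prop. 1, §2.2, §2.3 (2.3.2), §2.4 (i) [Serre1987].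
-/

noncomputable section

open scoped MatrixGroups Valued
open Field ValuativeRel

namespace Literature.NumberTheory.GaloisRepresentations

namespace ModPGaloisRep

open GaloisRepresentations.IsNonarchimedeanLocalField InertiaShape

universe u v

variable {F : Type u} [Field F] [ValuativeRel F] [TopologicalSpace F] [IsNonarchimedeanLocalField F]
variable {k : Type v} [Field k] [TopologicalSpace k]
variable {ρ : ModPGaloisRep F k 2} {ι : absIntegers 𝒪[F] F ⧸ absMaximalIdeal F →+* k}

/-! ### Bookkeeping on triangular forms -/

/-- The diagonal characters of a triangular form `P ρ̄ P⁻¹ = (χ^a c; 0 χ^b)` (any character `χ` of `I_F`) take the values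
`(χ σ ^ a, χ σ ^ b)` (private helper). [folklore] -/
private theorem diagChar_conjRestrict_of_shape {χ : absInertia F →* kˣ} {a b : ℕ} {P : GL (Fin 2) k}
    (hP : ∀ σ : absInertia F, ∃ c : k,
      ((P * ρ (σ : absoluteGaloisGroup F) * P⁻¹ : GL (Fin 2) k) : Matrix (Fin 2) (Fin 2) k) =
        !![((χ σ ^ a : kˣ) : k), c; 0, ((χ σ ^ b : kˣ) : k)]) :
    ∃ hf : ∀ σ, (conjRestrict ρ P σ : Matrix (Fin 2) (Fin 2) k) 1 0 = 0,
      (∀ σ, diagChar (conjRestrict ρ P) hf 0 σ = χ σ ^ a) ∧ (∀ σ, diagChar (conjRestrict ρ P) hf 1 σ = χ σ ^ b) := by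
  have hf : ∀ σ, (conjRestrict ρ P σ : Matrix (Fin 2) (Fin 2) k) 1 0 = 0 := by
    intro σ
    obtain ⟨c, hc⟩ := hP σ
    rw [conjRestrict_apply, hc]
    rfl
  refine ⟨hf, fun σ => ?_, fun σ => ?_⟩
  · obtain ⟨c, hc⟩ := hP σ
    ext
    rw [coe_diagChar_apply, conjRestrict_apply, hc]
    simp
  · obtain ⟨c, hc⟩ := hP σ
    ext
    rw [coe_diagChar_apply, conjRestrict_apply, hc]
    simp

/-- Two triangular forms are conjugate: `conjRestrict ρ R σ = (R P⁻¹) (conjRestrict ρ P σ) (R P⁻¹)⁻¹` (private helper). [folklore] -/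
private theorem conjRestrict_conj (P R : GL (Fin 2) k) (σ : absInertia F) :
    conjRestrict ρ R σ = (R * P⁻¹) * conjRestrict ρ P σ * (R * P⁻¹)⁻¹ := by
  rw [conjRestrict_apply, conjRestrict_apply, mul_inv_rev, inv_inv]
  group

/-- **Any two level-one triangular forms have the same exponent characters up to order** (values): if
`ρ̄|I ∼ (χ^β ∗; 0 χ^α)` and `ρ̄|I ∼ (χ^x ∗; 0 χ^y)` for one character `χ` then pointwise `(χ^x, χ^y) = (χ^β, χ^α)` or `(χ^α, χ^β)`
(`diagChar_eq_or_eq_swap`; private helper). [folklore] -/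
private theorem pow_eq_or_swap_of_two_shapes {χ : absInertia F →* kˣ} {β α x y : ℕ} {P R : GL (Fin 2) k}
    (hP : ∀ σ : absInertia F, ∃ c : k,
      ((P * ρ (σ : absoluteGaloisGroup F) * P⁻¹ : GL (Fin 2) k) : Matrix (Fin 2) (Fin 2) k) =
        !![((χ σ ^ β : kˣ) : k), c; 0, ((χ σ ^ α : kˣ) : k)])
    (hR : ∀ σ : absInertia F, ∃ c : k,
      ((R * ρ (σ : absoluteGaloisGroup F) * R⁻¹ : GL (Fin 2) k) : Matrix (Fin 2) (Fin 2) k) =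
        !![((χ σ ^ x : kˣ) : k), c; 0, ((χ σ ^ y : kˣ) : k)]) :
    (∀ σ, χ σ ^ x = χ σ ^ β ∧ χ σ ^ y = χ σ ^ α) ∨ (∀ σ, χ σ ^ x = χ σ ^ α ∧ χ σ ^ y = χ σ ^ β) := by
  obtain ⟨hf, hd0, hd1⟩ := diagChar_conjRestrict_of_shape hP
  obtain ⟨hr, hr0, hr1⟩ := diagChar_conjRestrict_of_shape hR
  rcases diagChar_eq_or_eq_swap (conjRestrict ρ P) (conjRestrict ρ R) hf hr (R * P⁻¹) (conjRestrict_conj P R) with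
    ⟨h0, h1⟩ | ⟨h0, h1⟩
  · left
    intro σ
    have e0 := congrArg (fun φ : absInertia F →* kˣ => φ σ) h0
    have e1 := congrArg (fun φ : absInertia F →* kˣ => φ σ) h1
    rw [hd0, hr0] at e0
    rw [hd1, hr1] at e1
    exact ⟨e0.symm, e1.symm⟩
  · right
    intro σ
    have e0 := congrArg (fun φ : absInertia F →* kˣ => φ σ) h0
    have e1 := congrArg (fun φ : absInertia F →* kˣ => φ σ) h1
    rw [hd0, hr1] at e0
    rw [hd1, hr0] at e1
    exact ⟨e1.symm, e0.symm⟩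

omit [TopologicalSpace k] in
/-- Exponents of `ψ₁` below `q − 1` are determined by the character: `ψ₁^x = ψ₁^y` pointwise, `x + 2 ≤ q`, `y + 2 ≤ q` ⟹ `x = y`
(`ψ₁` has order exactly `q − 1`, `ι` injective; private helper). [folklore] -/
private theorem exponent_eq_of_pow_eq (hι : Function.Injective ι) {ϖ : 𝒪[F]} (hϖ : Irreducible ϖ) {x y : ℕ}
    (hx : x + 2 ≤ residueFieldCard F) (hy : y + 2 ≤ residueFieldCard F)
    (hxy : ∀ σ, fundamentalCharacter F 1 ι ϖ hϖ σ ^ x = fundamentalCharacter F 1 ι ϖ hϖ σ ^ y) : x = y := by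
  have hord : ∀ e, fundamentalCharacter F 1 ι ϖ hϖ ^ e = 1 ↔ residueFieldCard F - 1 ∣ e := fun e =>
    fundamentalCharacter_one_pow_eq_one_iff ι hι ϖ hϖ e
  have key : ∀ {x y : ℕ}, x ≤ y → y + 2 ≤ residueFieldCard F →
      (∀ σ, fundamentalCharacter F 1 ι ϖ hϖ σ ^ x = fundamentalCharacter F 1 ι ϖ hϖ σ ^ y) → x = y := by
    intro x y hle hy hxy
    have h1 : fundamentalCharacter F 1 ι ϖ hϖ ^ (y - x) = 1 := by
      ext σ : 1
      rw [MonoidHom.pow_apply, MonoidHom.one_apply, pow_sub _ hle, ← hxy σ, mul_inv_cancel]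
    rcases Nat.eq_zero_or_pos (y - x) with h0 | hpos
    · omega
    · have := Nat.le_of_dvd hpos ((hord _).mp h1)
      omega
  rcases le_total x y with hle | hle
  · exact key hle hy hxy
  · exact (key hle hx fun σ => (hxy σ).symm).symm

omit [TopologicalSpace k] in
/-- `ψ₁ σ ^ (q − 1) = 1` pointwise (private helper). [folklore] -/
private theorem fundamentalCharacter_one_apply_pow_eq_one (ϖ : 𝒪[F]) (hϖ : Irreducible ϖ) (σ : absInertia F) :
    fundamentalCharacter F 1 ι ϖ hϖ σ ^ (residueFieldCard F - 1) = 1 := by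
  have := congrArg (fun φ : absInertia F →* kˣ => φ σ) (fundamentalCharacter_one_pow_eq_one F ι ϖ hϖ)
  simpa only [MonoidHom.pow_apply, MonoidHom.one_apply] using this

/-! ### No level-two weight in the presence of a level-one shape -/

/-- **A representation with a level-one inertia shape has no level-two weight** (`ι` injective, `k` arbitrary).  If
`ρ̄|I_F ∼ (ψ₁^β ∗; 0 ψ₁^α)` and also `ρ̄|I_F ≃ diag(ψ₂^{a+qb}, ψ₂^{qa+b})` with `0 ≤ a < b ≤ q − 1`, then (diagonal characters agree up
to order) `ψ₂^{a+qb}` is a power of `ψ₁`, so `(ψ₂^{a+qb})^{q−1} = 1` and — `ψ₂` having order `q² − 1` — `q + 1 ∣ a + qb`; but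
`a + qb = (q + 1)b − (b − a)` with `0 < b − a < q + 1`.  (Serre §2.2: the level-two characters are those with `a ≠ b`.)
[cite: Serre1987, §2.1 Prop. 1 and §2.2 (2.2.1)–(2.2.2)] -/
theorem not_isLevelTwoWeight_of_hasLevelOneInertiaShape (hι : Function.Injective ι)
    {ϖ : 𝒪[F]} (hϖ : Irreducible ϖ) {β α : ℕ} (h : ρ.HasLevelOneInertiaShape ι ϖ hϖ β α) (m : ℕ) :
    ¬ ρ.IsLevelTwoWeight ι m := by
  rintro ⟨a, b, hab, hbq, ⟨ϖ', hϖ', Q, hQ⟩, -⟩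
  obtain ⟨P, hP⟩ := h
  have hq1 : 1 < residueFieldCard F := one_lt_residueFieldCard F
  obtain ⟨hf, hd0, hd1⟩ := diagChar_conjRestrict_of_shape hP
  have hf' : ∀ σ, (conjRestrict ρ Q σ : Matrix (Fin 2) (Fin 2) k) 1 0 = 0 := by
    intro σ
    rw [conjRestrict_apply, hQ σ]
    rfl
  have he0 : ∀ σ, diagChar (conjRestrict ρ Q) hf' 0 σ = fundamentalCharacter F 2 ι ϖ' hϖ' σ ^ (a + residueFieldCard F * b) := by
    intro σ
    ext
    rw [coe_diagChar_apply, conjRestrict_apply, hQ σ]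
    simp
  -- `ψ₂^{a+qb}` is, pointwise, a power of `ψ₁`
  have hex : ∃ e : ℕ, ∀ σ, fundamentalCharacter F 2 ι ϖ' hϖ' σ ^ (a + residueFieldCard F * b) =
      fundamentalCharacter F 1 ι ϖ hϖ σ ^ e := by
    rcases diagChar_eq_or_eq_swap (conjRestrict ρ P) (conjRestrict ρ Q) hf hf' (Q * P⁻¹) (conjRestrict_conj P Q) with
      ⟨h0, -⟩ | ⟨-, h1⟩
    · refine ⟨β, fun σ => ?_⟩
      have e0 := congrArg (fun φ : absInertia F →* kˣ => φ σ) h0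
      rw [hd0, he0] at e0
      exact e0.symm
    · refine ⟨α, fun σ => ?_⟩
      have e1 := congrArg (fun φ : absInertia F →* kˣ => φ σ) h1
      rw [hd1, he0] at e1
      exact e1.symm
  obtain ⟨e, he⟩ := hex
  -- hence killed by `q - 1`
  have hkill : fundamentalCharacter F 2 ι ϖ' hϖ' ^ ((a + residueFieldCard F * b) * (residueFieldCard F - 1)) = 1 := by
    ext σ : 1
    rw [MonoidHom.pow_apply, MonoidHom.one_apply, pow_mul, he σ, ← pow_mul, mul_comm, pow_mul,
      fundamentalCharacter_one_apply_pow_eq_one ϖ hϖ σ, one_pow]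
  have hdvd : residueFieldCard F ^ 2 - 1 ∣ (a + residueFieldCard F * b) * (residueFieldCard F - 1) :=
    (fundamentalCharacter_pow_eq_one_iff two_ne_zero ι hι ϖ' hϖ' _).mp hkill
  have hq21 : residueFieldCard F ^ 2 - 1 = (residueFieldCard F + 1) * (residueFieldCard F - 1) := by
    rw [Nat.mul_sub_one, add_mul, one_mul, sq]
    omega
  rw [hq21] at hdvd
  have hdvd' : residueFieldCard F + 1 ∣ a + residueFieldCard F * b := Nat.dvd_of_mul_dvd_mul_right (by omega) hdvd
  -- `(q + 1) b - (a + q b) = b - a`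
  have hsub : residueFieldCard F + 1 ∣ b - a := by
    have h2 : residueFieldCard F + 1 ∣ (residueFieldCard F + 1) * b := dvd_mul_right _ _
    have h3 := Nat.dvd_sub h2 hdvd'
    have e : (residueFieldCard F + 1) * b - (a + residueFieldCard F * b) = b - a := by
      rw [add_mul, one_mul]
      omega
    rwa [e] at h3
  have hpos : 0 < b - a := by omega
  have := Nat.le_of_dvd hpos hsub
  omega

/-! ### The generic level-one evaluation -/

variable (ρ ι)

/-- **`k(ρ̄_F) = 1 + q·min(α, β) + max(α, β)` for a level-one shape `(ψ₁^β ∗; 0 ψ₁^α)` in the generic range** `1 ≤ α, β ≤ q − 2`,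
`β ≠ α + 1`, `α ≠ β + 1` — UNCONDITIONALLY (`k` discrete; `ι` is automatically injective).  TAME: (2.3.2) with
`(a, b) = (min, max)`, every tame normalisation giving the same exponents; WILD: §2.4 (i), every wild normalisation giving the same
unordered exponents and never `β' = α' + 1`.  The level-two case does not occur (`not_isLevelTwoWeight_of_hasLevelOneInertiaShape`).
[cite: Serre1987, §2.3 (2.3.2), §2.4 (i) and (2.4.2)–(2.4.3) (unicité de α, β)] -/
theorem serreWeightLocal_eq_of_hasLevelOneInertiaShape_generic [DiscreteTopology k]
    {ϖ : 𝒪[F]} (hϖ : Irreducible ϖ) {β α : ℕ} (h : ρ.HasLevelOneInertiaShape ι ϖ hϖ β α)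
    (hα1 : 1 ≤ α) (hαq : α + 2 ≤ residueFieldCard F) (hβ1 : 1 ≤ β) (hβq : β + 2 ≤ residueFieldCard F)
    (hne : β ≠ α + 1) (hne' : α ≠ β + 1) :
    ρ.serreWeightLocal ι = 1 + residueFieldCard F * min α β + max α β := by
  classical
  have hι : Function.Injective ι := residueEmbedding_injective ι
  -- no level-two weight
  have h2 : ¬ ∃ m, ρ.IsLevelTwoWeight ι m := fun ⟨m, hm⟩ =>
    not_isLevelTwoWeight_of_hasLevelOneInertiaShape hι hϖ h m hm
  obtain ⟨P, hP⟩ := id h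
  -- comparison with any other level-one normalisation `(x, y)` (w.r.t. any uniformiser)
  have hcmp : ∀ {ϖ' : 𝒪[F]} {hϖ' : Irreducible ϖ'} {x y : ℕ}, ρ.HasLevelOneInertiaShape ι ϖ' hϖ' x y →
      (∀ σ, fundamentalCharacter F 1 ι ϖ hϖ σ ^ x = fundamentalCharacter F 1 ι ϖ hϖ σ ^ β ∧
          fundamentalCharacter F 1 ι ϖ hϖ σ ^ y = fundamentalCharacter F 1 ι ϖ hϖ σ ^ α) ∨
        (∀ σ, fundamentalCharacter F 1 ι ϖ hϖ σ ^ x = fundamentalCharacter F 1 ι ϖ hϖ σ ^ α ∧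
          fundamentalCharacter F 1 ι ϖ hϖ σ ^ y = fundamentalCharacter F 1 ι ϖ hϖ σ ^ β) := by
    intro ϖ' hϖ' x y hR
    obtain ⟨R, hR⟩ := hR
    have hχ' : fundamentalCharacter F 1 ι ϖ' hϖ' = fundamentalCharacter F 1 ι ϖ hϖ :=
      fundamentalCharacter_eq_holds F 1 ι ϖ' ϖ hϖ' hϖ
    have hR' : ∀ σ : absInertia F, ∃ c : k,
        ((R * ρ (σ : absoluteGaloisGroup F) * R⁻¹ : GL (Fin 2) k) : Matrix (Fin 2) (Fin 2) k) =
          !![((fundamentalCharacter F 1 ι ϖ hϖ σ ^ x : kˣ) : k), c; 0, ((fundamentalCharacter F 1 ι ϖ hϖ σ ^ y : kˣ) : k)] := by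
      intro σ; obtain ⟨c, hc⟩ := hR σ; exact ⟨c, by rw [hc, hχ']⟩
    exact pow_eq_or_swap_of_two_shapes hP hR'
  by_cases ht : ρ.IsTamelyRamified
  · -- TAME: the shape `(min, max)` is available, and every tame normalisation is `(min, max)`
    have hshape : ρ.HasLevelOneInertiaShape ι ϖ hϖ (min α β) (max α β) := by
      rcases le_total β α with hle | hle
      · rw [min_eq_right hle, max_eq_left hle]; exact h
      · rw [min_eq_left hle, max_eq_right hle]; exact h.symm_of_isTamelyRamified ht
    have hmem : ρ.IsLevelOneTameWeight ι (1 + residueFieldCard F * min α β + max α β) := by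
      refine ⟨ht, min α β, max α β, min_le_max, ?_, ⟨ϖ, hϖ, hshape⟩, ?_⟩
      · rcases le_total β α with hle | hle
        · rw [max_eq_left hle]; exact hαq
        · rw [max_eq_right hle]; exact hβq
      · rw [if_neg (by rintro ⟨h0, -⟩; have := le_min hα1 hβ1; omega)]
    have hall : ∀ m ∈ {m | ρ.IsLevelOneTameWeight ι m}, m = 1 + residueFieldCard F * min α β + max α β := by
      rintro m ⟨-, a', b', hab, hbq, hs, rfl⟩
      obtain ⟨ϖ', hϖ', hs⟩ := hs
      rcases hcmp hs with hxy | hxy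
      · have ha : a' = β := exponent_eq_of_pow_eq hι hϖ (by omega) hβq fun σ => (hxy σ).1
        have hb : b' = α := exponent_eq_of_pow_eq hι hϖ hbq hαq fun σ => (hxy σ).2
        subst ha; subst hb
        rw [if_neg (by rintro ⟨h0, -⟩; omega), min_eq_right hab, max_eq_left hab]
      · have ha : a' = α := exponent_eq_of_pow_eq hι hϖ (by omega) hαq fun σ => (hxy σ).1
        have hb : b' = β := exponent_eq_of_pow_eq hι hϖ hbq hβq fun σ => (hxy σ).2
        subst ha; subst hb
        rw [if_neg (by rintro ⟨h0, -⟩; omega), min_eq_left hab, max_eq_right hab]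
    unfold serreWeightLocal
    rw [if_neg h2, if_pos ht]
    exact le_antisymm (Nat.sInf_le hmem) (le_csInf ⟨_, hmem⟩ fun m hm => (hall m hm).symm.le)
  · -- WILD: §2.4 (i) with `(α', β') = (α, β)`; every wild normalisation has the same unordered exponents
    have hmem : ρ.IsLevelOneWildWeight ι (1 + residueFieldCard F * min α β + max α β) := by
      refine ⟨ht, α, β, hαq, hβ1, by omega, ⟨ϖ, hϖ, h⟩, ?_⟩
      rw [if_neg (by rintro ⟨h0, -⟩; exact hne h0)]
    have hall : ∀ m ∈ {m | ρ.IsLevelOneWildWeight ι m}, m = 1 + residueFieldCard F * min α β + max α β := by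
      rintro m ⟨-, a', b', haq, hb1, hbq, hs, rfl⟩
      obtain ⟨ϖ', hϖ', hs⟩ := hs
      have hord : ∀ e, fundamentalCharacter F 1 ι ϖ hϖ ^ e = 1 ↔ residueFieldCard F - 1 ∣ e := fun e =>
        fundamentalCharacter_one_pow_eq_one_iff ι hι ϖ hϖ e
      -- the first exponent `b'` of the wild normalisation is not `q - 1` (neither `ψ₁^β` nor `ψ₁^α` is trivial)
      have hbq' : b' + 2 ≤ residueFieldCard F := by
        by_contra hcon
        have hb' : b' = residueFieldCard F - 1 := by omega
        have htriv : ∀ {e : ℕ}, (∀ σ, fundamentalCharacter F 1 ι ϖ hϖ σ ^ b' = fundamentalCharacter F 1 ι ϖ hϖ σ ^ e) →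
            residueFieldCard F - 1 ∣ e := by
          intro e hσ
          refine (hord e).mp ?_
          ext σ : 1
          rw [MonoidHom.pow_apply, MonoidHom.one_apply, ← hσ σ, hb', fundamentalCharacter_one_apply_pow_eq_one ϖ hϖ σ]
        rcases hcmp hs with hxy | hxy
        · have := Nat.le_of_dvd (by omega) (htriv fun σ => (hxy σ).1)
          omega
        · have := Nat.le_of_dvd (by omega) (htriv fun σ => (hxy σ).1)
          omega
      rcases hcmp hs with hxy | hxy
      · have hb : b' = β := exponent_eq_of_pow_eq hι hϖ hbq' hβq fun σ => (hxy σ).1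
        have ha : a' = α := exponent_eq_of_pow_eq hι hϖ haq hαq fun σ => (hxy σ).2
        subst ha; subst hb
        rw [if_neg (by rintro ⟨h0, -⟩; exact hne h0)]
      · have hb : b' = α := exponent_eq_of_pow_eq hι hϖ hbq' hαq fun σ => (hxy σ).1
        have ha : a' = β := exponent_eq_of_pow_eq hι hϖ haq hβq fun σ => (hxy σ).2
        subst ha; subst hb
        rw [if_neg (by rintro ⟨h0, -⟩; exact hne' h0), min_comm, max_comm]
    unfold serreWeightLocal
    rw [if_neg h2, if_neg ht]
    exact le_antisymm (Nat.sInf_le hmem) (le_csInf ⟨_, hmem⟩ fun m hm => (hall m hm).symm.le)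

variable {ρ ι}

/-- **Global form**: for a local restriction datum `loc` at `p` of `ρ̄ : Γ_ℚ → GL₂(k)` with `loc.rep|I ∼ (ω^β ∗; 0 ω^α)`,
`1 ≤ α, β ≤ p − 2`, `|α − β| ≠ 1`: `serreWeight p ρ̄ loc ι = 1 + p·min(α, β) + max(α, β)`, unconditionally.
[cite: Serre1987, §2.3 (2.3.2), §2.4 (i)] -/
theorem serreWeight_eq_of_hasLevelOneInertiaShape_generic [DiscreteTopology k] {p : ℕ} {ρ : ModPGaloisRep ℚ k 2}
    (loc : LocalRestrictionAt p ρ) (ι : absIntegers 𝒪[loc.F] loc.F ⧸ absMaximalIdeal loc.F →+* k) {β α : ℕ}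
    (h : loc.rep.HasLevelOneInertiaShape ι ((p : ℕ) : 𝒪[loc.F]) loc.irreducible_natCast β α)
    (hα1 : 1 ≤ α) (hαp : α + 2 ≤ p) (hβ1 : 1 ≤ β) (hβp : β + 2 ≤ p) (hne : β ≠ α + 1) (hne' : α ≠ β + 1) :
    serreWeight p ρ loc ι = 1 + p * min α β + max α β := by
  have hq := loc.residueFieldCard_eq
  have e := serreWeightLocal_eq_of_hasLevelOneInertiaShape_generic loc.rep ι loc.irreducible_natCast h hα1
    (by rw [hq]; exact hαp) hβ1 (by rw [hq]; exact hβp) hne hne'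
  rw [hq] at e
  exact e

end ModPGaloisRep

end Literature.NumberTheory.GaloisRepresentations
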